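import Literature.Topology.FourManifolds.Spin
import Mathlib.Geometry.Manifold.ContMDiffMFDeriv
import Mathlib.Geometry.Manifold.ContMDiff.NormedSpace
import Mathlib.Geometry.Manifold.MFDeriv.SpecificFunctions
import HarnessLib

/-!
# Parallelizable spheres: the classical half of `Literature.Topology.FourManifolds.isParallelizable_sphere_iff`

Sibling proof file of `Spin.lean` (D-0014). The named fact

* `Literature.isParallelizable_sphere_iff : ∀ n, IsParallelizable (𝓡 n) 𝕊ⁿ ↔ n ∈ {0, 1, 3, 7}`
  (Bott–Milnor 1958, Kervaire 1958)

is the conjunction of two results of very different depth. This file **proves the "if" half**,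

* `Literature.isParallelizable_sphere_of_mem : n ∈ {0, 1, 3, 7} → IsParallelizable (𝓡 n) 𝕊ⁿ`
  (`𝕊⁰` has a rank-`0` tangent bundle; `𝕊¹, 𝕊³, 𝕊⁷` are framed by complex, quaternionic and
  octonionic multiplication),

sorry-free, for Mathlib's manifold structure on `𝕊ⁿ = Metric.sphere (0 : EuclideanSpace ℝ
(Fin (n + 1))) 1` (stereographic charts) and the honest definition `Literature.Topology.FourManifolds.IsParallelizable`
(`dim` continuous sections of Mathlib's `TangentBundle`, pointwise linearly independent). The
"only if" half (non-parallelizability of `𝕊ⁿ` for `n ∉ {0, 1, 3, 7}`: Bott periodicity /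
`K`-theory and Stiefel–Whitney classes, none of which Mathlib has) stays a named fact,
`Literature.Topology.FourManifolds.isParallelizable_sphere_onlyIf` in `SpinSphereFacts.lean`, which also records the reduction
`isParallelizable_sphere_iff_of_onlyIf`.

## Sources

* J. Dieudonné, *Treatise on Analysis*, Vol. III (1972), Ch. XVI, (16.15) Problems 1–2: Lie
  groups (hence `S₁`, `S₃`) are parallelizable; a bilinear `m : ℝᵏ × ℝⁿ → ℝⁿ` with
  `‖m(y, x)‖ = ‖y‖ ‖x‖` yields `k - 1` pointwise independent vector fields on `S_{n-1}`, "in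
  particular `S₇` is a parallelizable manifold" [DieudonneAnalysisIII1972].
* H.-D. Ebbinghaus et al., *Numbers*, GTM 123 (1991), Ch. 11 (F. Hirzebruch), §1.5 Theorem: if a
  division algebra of dimension `n` exists then `S^{n-1}` is parallelizable (frame `y ↦ eᵢ · y`);
  §2.2: "the sphere `S^{n-1}` is parallelizable only for `n = 1, 2, 4, 8`" [EbbinghausEtAl1991].
* J. M. Lee, *Introduction to Smooth Manifolds*, 2nd ed., Ch. 8: Cor. 8.39 (Lie groups are
  parallelizable, by left-invariant frames), Problems 8-6, 8-7 (`𝕊³`, `𝕊⁷` via `ℍ`, `𝕆`), p. 179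
  (Bott–Milnor, Kervaire: these are the only parallelizable spheres) [LeeSmoothManifolds2013].

## Proof

Mathlib describes `T 𝕊ⁿ` only through charts (`TangentSpace (𝓡 n) x = EuclideanSpace ℝ (Fin n)`,
topologised by the derivatives of the stereographic chart changes), so "the ambient vector `eᵢ · x`
is tangent at `x` and depends continuously on `x`" is not directly expressible. We instead follow
the left-invariant-vector-field construction of Mathlib's `contMDiff_mulInvariantVectorField`
(file `Mathlib/Geometry/Manifold/GroupLieAlgebra.lean`), freed from associativity and inverses:

1. `contMDiff_mfderiv_mul_right_unit`: for a jointly `C^{m+1}` operation `μ : M → M → M` with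
   `μ g e = g`, and `ξ ∈ T_e M`, the section `g ↦ D(μ g)(e) ξ ∈ T_g M` of `TM` is `C^m`: it is the
   composite of the smooth maps `g ↦ ((g, 0), (e, ξ)) ∈ TM × TM ≅ T(M × M)`
   (`contMDiff_equivTangentBundleProd_symm`) and `T μ : T(M × M) → TM`
   (`ContMDiff.contMDiff_tangentMap`), by the Leibniz formula `mfderiv_prod_eq_add_apply`.
2. `isParallelizable_of_contMDiff_mul`: if moreover each `D(μ g)(e)` is injective, the images of a
   basis of `T_e M = E` frame `TM` (`Literature.Topology.FourManifolds.IsParallelizable`); in particular every group with a `C¹`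
   multiplication on a finite-dimensional manifold is parallelizable
   (`isParallelizable_of_contMDiffMul`: Dieudonné (16.15) Problem 1, Lee Cor. 8.39).
3. `isParallelizable_sphere_of_norm_mul`: a continuous bilinear `B` on an `(n+1)`-dimensional
   inner product space `F` with `‖B g x‖ = ‖g‖ ‖x‖` and `B g e = g` restricts to a real-analytic
   `μ : 𝕊ⁿ × 𝕊ⁿ → 𝕊ⁿ` (`contMDiff_coe_sphere`, `ContMDiff.codRestrict_sphere`,
   `ContMDiff.clm_apply`); `D(μ g)(e)` is injective because, composed with the injective
   `D(incl)(g)` (`mfderiv_coe_sphere_injective`), it equals the isometry `B g` composed with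
   `D(incl)(e)` (chain rule `mfderiv_comp`, `ContinuousLinearMap.mfderiv_eq`).
4. `exists_norm_mul_two/four/eight`: `ℂ`, `ℍ`, `𝕆` written as explicit bilinear maps on
   `EuclideanSpace ℝ (Fin 2/4/8)` (Cayley–Dickson doubling `(a,b)(c,d) = (ac - d̄b, da + bc̄)`),
   with unit `e₀` and multiplicative norm (the two-, four- and eight-square identities, by `ring`).
5. `isParallelizable_sphere_zero/one/three/seven`, `isParallelizable_sphere_of_mem`.

Design: theorems only (no definitions, instances or global notation). Mathlib's
`Fact (finrank ℝ (EuclideanSpace ℝ (Fin (n + 1))) = n + 1)`, consumed by its sphere API, is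
supplied inside the proofs by `haveI`, as Mathlib does in `EuclideanSpace.instIsManifoldSphere`;
the general statements are over any finite-dimensional real inner product space `F` with
`[Fact (finrank ℝ F = n + 1)]`, like Mathlib's `contMDiff_coe_sphere`.
-/

open scoped Manifold ContDiff Topology
open Set Module Bundle Function

noncomputable section

namespace Literature.Topology.FourManifolds

section MulVectorField

variable {E H : Type*} [NormedAddCommGroup E] [NormedSpace ℝ E] [TopologicalSpace H]
  {I : ModelWithCorners ℝ E H} {M : Type*} [TopologicalSpace M] [ChartedSpace H M]

/-- **Smooth vector fields from a smooth binary operation** (Mathlib's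
`contMDiff_mulInvariantVectorField` without associativity or inverses): if `μ : M → M → M` is
jointly `C^k`, `m + 1 ≤ k`, and `e` is a right unit (`μ g e = g` for all `g`), then for every
`ξ ∈ T_e M` the field `g ↦ D(μ g)(e) ξ ∈ T_g M` is a `C^m` section of `TM` (for Lie groups:
Lee, *Introduction to Smooth Manifolds*, Cor. 8.39, left-invariant frames).
[cite: LeeSmoothManifolds2013, Cor. 8.39] -/
theorem contMDiff_mfderiv_mul_right_unit {k m : ℕ∞ω} [IsManifold I 1 M] [IsManifold I k M]
    {μ : M → M → M} {e : M} (hμ : CMDiff k (fun p : M × M ↦ μ p.1 p.2)) (hmk : m + 1 ≤ k)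
    (he : ∀ g, μ g e = g) (ξ : TangentSpace I e) :
    CMDiff m (fun g ↦ (TotalSpace.mk' E g (mfderiv I I (μ g) e ξ) : TangentBundle I M)) := by
  have hm1 : k ≠ 0 := ((zero_lt_one.trans_le le_add_self).trans_le hmk).ne'
  let fg : M → TangentBundle I M := fun g ↦ TotalSpace.mk' E g 0
  have sfg : CMDiff m fg := contMDiff_zeroSection _ _
  let fv : M → TangentBundle I M := fun _ ↦ TotalSpace.mk' E e ξ
  have sfv : CMDiff m fv := contMDiff_const
  let F₁ : M → TangentBundle I M × TangentBundle I M := fun g ↦ (fg g, fv g)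
  have S₁ : CMDiff m F₁ := sfg.prodMk sfv
  let F₂ : TangentBundle I M × TangentBundle I M → TangentBundle (I.prod I) (M × M) :=
    (equivTangentBundleProd I M I M).symm
  have S₂ : CMDiff m F₂ := contMDiff_equivTangentBundleProd_symm
  let F₃ : TangentBundle (I.prod I) (M × M) → TangentBundle I M :=
    tangentMap (I.prod I) I (fun p : M × M ↦ μ p.1 p.2)
  have S₃ : CMDiff m F₃ := hμ.contMDiff_tangentMap hmk
  have S := (S₃.comp S₂).comp S₁
  -- identify the composite with the required section (an equality in the total space, whose
  -- fibres are all the model space `E`, so no heterogeneous equality is needed)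
  have hext : ∀ (p : TangentBundle I M) (b : M) (v : E), p.proj = b → p.snd = v →
      p = TotalSpace.mk' E b v := by
    rintro ⟨b', v'⟩ b v rfl (rfl : v' = v)
    rfl
  have key : ∀ g, ((F₃ ∘ F₂) ∘ F₁) g = TotalSpace.mk' E g (mfderiv I I (μ g) e ξ) := by
    intro g
    refine hext _ _ _ ?_ ?_
    · simp [F₁, F₂, F₃, fg, fv, tangentMap, he]
    · change mfderiv (I.prod I) I (fun p : M × M ↦ μ p.1 p.2) (g, e)
          ((0 : TangentSpace I g), ξ) = mfderiv I I (μ g) e ξ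
      rw [mfderiv_prod_eq_add_apply (hμ.mdifferentiableAt hm1)]
      dsimp only
      rw [map_zero, zero_add]
  have hfun : (fun g ↦ (TotalSpace.mk' E g (mfderiv I I (μ g) e ξ) : TangentBundle I M)) =
      (F₃ ∘ F₂) ∘ F₁ := funext fun g ↦ (key g).symm
  rw [hfun]
  exact S

/-- **Parallelizability from a smooth multiplication with a right unit.** If `μ : M → M → M`
is jointly `C¹`, `μ g e = g` for all `g`, and every differential `D(μ g)(e) : T_e M → T_g M` is
injective, then `M` is parallelizable: the images of a basis of `T_e M` are `dim M` continuous,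
pointwise linearly independent vector fields (for Lie groups: Dieudonné, *Treatise on Analysis*
III, (16.15) Problem 1; Lee, *Introduction to Smooth Manifolds*, Cor. 8.39: "every Lie group
admits a left-invariant smooth global frame"). [cite: LeeSmoothManifolds2013, Cor. 8.39] -/
theorem isParallelizable_of_contMDiff_mul [IsManifold I 1 M] [FiniteDimensional ℝ E]
    {μ : M → M → M} {e : M} (hμ : CMDiff 1 (fun p : M × M ↦ μ p.1 p.2)) (he : ∀ g, μ g e = g)
    (hinj : ∀ g, Injective (mfderiv I I (μ g) e)) : IsParallelizable I M := by
  let b := Module.finBasis ℝ E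
  refine ⟨fun i g ↦ mfderiv I I (μ g) e (b i), fun i ↦ ?_, fun g ↦ ?_⟩
  · exact (contMDiff_mfderiv_mul_right_unit (m := 0) hμ (by simp) he (b i)).continuous
  · have hker : LinearMap.ker ((mfderiv I I (μ g) e).toLinearMap) = ⊥ :=
      LinearMap.ker_eq_bot_of_injective (hinj g)
    exact b.linearIndependent.map' _ hker

/-- **Lie groups are parallelizable** (Dieudonné, *Treatise on Analysis* III, (16.15) Problem 1;
Lee, *Introduction to Smooth Manifolds*, Cor. 8.39: left-invariant frames). A group with a `C¹`
multiplication on a finite-dimensional `C¹` manifold (`ContMDiffMul I 1 G`; smoothness of the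
inversion is not needed) is parallelizable: apply `isParallelizable_of_contMDiff_mul` to
`μ g h = g * h`, `e = 1`; `D(L_g)(1)` is injective since `L_{g⁻¹} ∘ L_g = id`.
[cite: LeeSmoothManifolds2013, Cor. 8.39] [cite: DieudonneAnalysisIII1972, (16.15) Problem 1] -/
theorem isParallelizable_of_contMDiffMul [FiniteDimensional ℝ E] {G : Type*} [Group G]
    [TopologicalSpace G] [ChartedSpace H G] [ContMDiffMul I 1 G] : IsParallelizable I G := by
  refine isParallelizable_of_contMDiff_mul (μ := fun g h : G ↦ g * h) (e := 1)
    (contMDiff_mul I 1) mul_one fun g ↦ ?_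
  have hL : ∀ a : G, MDifferentiableAt I I (fun x : G ↦ a * x) (1 : G) := fun a ↦
    contMDiff_mul_left.mdifferentiableAt one_ne_zero
  have hL' : MDifferentiableAt I I (fun x : G ↦ g⁻¹ * x) (g * 1) :=
    contMDiff_mul_left.mdifferentiableAt one_ne_zero
  have A : mfderiv I I ((fun x : G ↦ g⁻¹ * x) ∘ fun x : G ↦ g * x) 1 =
      ContinuousLinearMap.id ℝ (TangentSpace I (1 : G)) := by
    have : ((fun x : G ↦ g⁻¹ * x) ∘ fun x : G ↦ g * x) = id := by
      ext x; simp
    rw [this]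
    exact mfderiv_id
  rw [mfderiv_comp (1 : G) hL' (hL g)] at A
  intro v w hvw
  have := congrArg (mfderiv I I (fun x : G ↦ g⁻¹ * x) (g * 1)) hvw
  rwa [← ContinuousLinearMap.comp_apply, ← ContinuousLinearMap.comp_apply, A] at this

end MulVectorField

/-! ### Spheres of normed algebras -/

section NormMul

open Metric

variable {F : Type*} [NormedAddCommGroup F] [InnerProductSpace ℝ F] {n : ℕ}
  [Fact (finrank ℝ F = n + 1)]

/-- **A bilinear multiplication with multiplicative norm and a right unit frames the unit
sphere** (Dieudonné, *Treatise on Analysis* III (1972), (16.15) Problem 2; Ebbinghaus et al.,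
*Numbers*, Ch. 11 (Hirzebruch), §1.5 Theorem: "if a division algebra of dimension `n` exists then
`S^{n-1}` is parallelizable"). If `B` is a continuous bilinear map on the `(n+1)`-dimensional real
inner product space `F` with `‖B g x‖ = ‖g‖ ‖x‖` and `B g e = g` for all `g, x`, then the left
multiplications `x ↦ B g x`, `‖g‖ = 1`, are linear isometries of `F` mapping the unit sphere to
itself and `e` to `g`, so their differentials at `e` carry a basis of `T_e 𝕊ⁿ` to a continuous
framing of `T 𝕊ⁿ` (`isParallelizable_of_contMDiff_mul`).
[cite: DieudonneAnalysisIII1972, (16.15) Problem 2]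
[cite: EbbinghausEtAl1991, Ch. 11 §1.5 Theorem] -/
theorem isParallelizable_sphere_of_norm_mul (B : F →L[ℝ] F →L[ℝ] F) (e : F)
    (hBe : ∀ g, B g e = g) (hB : ∀ g x, ‖B g x‖ = ‖g‖ * ‖x‖) :
    IsParallelizable (𝓡 n) (sphere (0 : F) 1) := by
  -- the right unit has norm one
  have he1 : ‖e‖ = 1 := by
    have hpos : 0 < finrank ℝ F := by
      rw [Fact.out (p := finrank ℝ F = n + 1)]
      exact Nat.succ_pos n
    haveI : Nontrivial F := Module.nontrivial_of_finrank_pos hpos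
    obtain ⟨g, hg⟩ := exists_ne (0 : F)
    have h := hB g e
    rw [hBe] at h
    have h' : ‖g‖ * ‖e‖ = ‖g‖ * 1 := by rw [mul_one]; exact h.symm
    exact mul_left_cancel₀ (norm_ne_zero_iff.2 hg) h'
  have hmem : ∀ g x : sphere (0 : F) 1, B g x ∈ sphere (0 : F) 1 := fun g x ↦ by
    rw [mem_sphere_zero_iff_norm, hB, norm_eq_of_mem_sphere g, norm_eq_of_mem_sphere x, mul_one]
  set μ : sphere (0 : F) 1 → sphere (0 : F) 1 → sphere (0 : F) 1 := fun g x ↦ ⟨B g x, hmem g x⟩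
    with hμ_def
  let e' : sphere (0 : F) 1 := ⟨e, mem_sphere_zero_iff_norm.2 he1⟩
  have hval : ContMDiff (𝓡 n) 𝓘(ℝ, F) ω ((↑) : sphere (0 : F) 1 → F) := contMDiff_coe_sphere
  have hμ : ContMDiff ((𝓡 n).prod (𝓡 n)) (𝓡 n) ω
      (fun p : sphere (0 : F) 1 × sphere (0 : F) 1 ↦ μ p.1 p.2) := by
    have h1 : ContMDiff ((𝓡 n).prod (𝓡 n)) 𝓘(ℝ, F →L[ℝ] F) ω
        (fun p : sphere (0 : F) 1 × sphere (0 : F) 1 ↦ B (p.1 : F)) :=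
      B.contDiff.contMDiff.comp (hval.comp contMDiff_fst)
    have h2 : ContMDiff ((𝓡 n).prod (𝓡 n)) 𝓘(ℝ, F) ω
        (fun p : sphere (0 : F) 1 × sphere (0 : F) 1 ↦ (p.2 : F)) :=
      hval.comp contMDiff_snd
    exact (h1.clm_apply h2).codRestrict_sphere (fun p ↦ hmem p.1 p.2)
  have he' : ∀ g, μ g e' = g := fun g ↦ Subtype.ext (hBe g)
  refine isParallelizable_of_contMDiff_mul (hμ.of_le le_top) he' fun g ↦ ?_
  have hμg : ContMDiff (𝓡 n) (𝓡 n) ω (μ g) := hμ.comp (contMDiff_const.prodMk contMDiff_id)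
  have hcomp : mfderiv (𝓡 n) 𝓘(ℝ, F) (((↑) : sphere (0 : F) 1 → F) ∘ μ g) e' =
      (mfderiv (𝓡 n) 𝓘(ℝ, F) ((↑) : sphere (0 : F) 1 → F) (μ g e')).comp
        (mfderiv (𝓡 n) (𝓡 n) (μ g) e') :=
    mfderiv_comp e' (hval.mdifferentiableAt (by simp)) (hμg.mdifferentiableAt (by simp))
  have hcomp' : mfderiv (𝓡 n) 𝓘(ℝ, F) (((↑) : sphere (0 : F) 1 → F) ∘ μ g) e' =
      (B g).comp (mfderiv (𝓡 n) 𝓘(ℝ, F) ((↑) : sphere (0 : F) 1 → F) e') := by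
    have : ((↑) : sphere (0 : F) 1 → F) ∘ μ g = (B g) ∘ ((↑) : sphere (0 : F) 1 → F) := rfl
    rw [this, mfderiv_comp e' (B (g : F)).mdifferentiableAt (hval.mdifferentiableAt (by simp)),
      ContinuousLinearMap.mfderiv_eq]
    rfl
  have hBg : Injective (B g) := by
    intro x y hxy
    have h0 : ‖B g (x - y)‖ = 0 := by rw [map_sub, hxy, sub_self, norm_zero]
    rw [hB, norm_eq_of_mem_sphere g, one_mul, norm_eq_zero] at h0
    exact sub_eq_zero.1 h0
  have key : Injective ((mfderiv (𝓡 n) 𝓘(ℝ, F) ((↑) : sphere (0 : F) 1 → F) (μ g e')) ∘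
      (mfderiv (𝓡 n) (𝓡 n) (μ g) e')) := by
    have h2 : ⇑(mfderiv (𝓡 n) 𝓘(ℝ, F) (((↑) : sphere (0 : F) 1 → F) ∘ μ g) e') =
        (mfderiv (𝓡 n) 𝓘(ℝ, F) ((↑) : sphere (0 : F) 1 → F) (μ g e')) ∘
          (mfderiv (𝓡 n) (𝓡 n) (μ g) e') := by
      rw [hcomp]; rfl
    have h3 : ⇑(mfderiv (𝓡 n) 𝓘(ℝ, F) (((↑) : sphere (0 : F) 1 → F) ∘ μ g) e') =
        (B g) ∘ (mfderiv (𝓡 n) 𝓘(ℝ, F) ((↑) : sphere (0 : F) 1 → F) e') := by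
      rw [hcomp']; rfl
    rw [← h2, h3]
    exact hBg.comp (mfderiv_coe_sphere_injective e')
  exact key.of_comp

end NormMul

/-! ### The normed algebras `ℂ`, `ℍ`, `𝕆` on `ℝ²`, `ℝ⁴`, `ℝ⁸` -/

section Algebras

/-- **Complex multiplication on `ℝ²`** as a continuous bilinear map with multiplicative norm
(the two-square identity) and unit `e₀`. [folklore] -/
theorem exists_norm_mul_two :
    ∃ B : EuclideanSpace ℝ (Fin 2) →L[ℝ] EuclideanSpace ℝ (Fin 2) →L[ℝ] EuclideanSpace ℝ (Fin 2),
      (∀ g, B g (EuclideanSpace.single 0 1) = g) ∧ ∀ g x, ‖B g x‖ = ‖g‖ * ‖x‖ := by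
  -- the multiplication, kept opaque (`m`, `hm`) so that the case splits below stay small
  obtain ⟨m, hm⟩ :
      ∃ m : EuclideanSpace ℝ (Fin 2) → EuclideanSpace ℝ (Fin 2) → EuclideanSpace ℝ (Fin 2), ∀ g x,
        m g x = !₂[g 0 * x 0 - g 1 * x 1, g 0 * x 1 + g 1 * x 0] :=
    ⟨_, fun _ _ ↦ rfl⟩
  have hnorm : ∀ g x, ‖m g x‖ = ‖g‖ * ‖x‖ := fun g x ↦ by
    have hsq : ‖m g x‖ ^ 2 = (‖g‖ * ‖x‖) ^ 2 := by
      rw [mul_pow, EuclideanSpace.real_norm_sq_eq, EuclideanSpace.real_norm_sq_eq,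
        EuclideanSpace.real_norm_sq_eq]
      simp [hm, Fin.sum_univ_two]
      ring
    exact (sq_eq_sq₀ (norm_nonneg _) (by positivity)).1 hsq
  have hunit : ∀ g, m g (EuclideanSpace.single 0 1) = g := fun g ↦ by
    ext i; fin_cases i <;> simp [hm]
  have hadd₁ : ∀ g₁ g₂ x, m (g₁ + g₂) x = m g₁ x + m g₂ x := fun g₁ g₂ x ↦ by
    ext i; fin_cases i <;> simp [hm] <;> ring
  have hsmul₁ : ∀ (c : ℝ) g x, m (c • g) x = c • m g x := fun c g x ↦ by
    ext i; fin_cases i <;> simp [hm] <;> ring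
  have hadd₂ : ∀ g x₁ x₂, m g (x₁ + x₂) = m g x₁ + m g x₂ := fun g x₁ x₂ ↦ by
    ext i; fin_cases i <;> simp [hm] <;> ring
  have hsmul₂ : ∀ (c : ℝ) g x, m g (c • x) = c • m g x := fun c g x ↦ by
    ext i; fin_cases i <;> simp [hm] <;> ring
  clear hm
  refine ⟨(LinearMap.mk₂ ℝ m hadd₁ hsmul₁ hadd₂ hsmul₂).mkContinuous₂ 1 fun g x ↦ ?_,
    fun g ↦ ?_, fun g x ↦ ?_⟩
  · rw [LinearMap.mk₂_apply, hnorm, one_mul]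
  · rw [LinearMap.mkContinuous₂_apply, LinearMap.mk₂_apply, hunit]
  · rw [LinearMap.mkContinuous₂_apply, LinearMap.mk₂_apply, hnorm]

/-- **Quaternion multiplication on `ℝ⁴`** as a continuous bilinear map with multiplicative norm
(Euler's four-square identity) and unit `e₀`. [folklore] -/
theorem exists_norm_mul_four :
    ∃ B : EuclideanSpace ℝ (Fin 4) →L[ℝ] EuclideanSpace ℝ (Fin 4) →L[ℝ] EuclideanSpace ℝ (Fin 4),
      (∀ g, B g (EuclideanSpace.single 0 1) = g) ∧ ∀ g x, ‖B g x‖ = ‖g‖ * ‖x‖ := by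
  -- the multiplication, kept opaque (`m`, `hm`) so that the case splits below stay small
  obtain ⟨m, hm⟩ :
      ∃ m : EuclideanSpace ℝ (Fin 4) → EuclideanSpace ℝ (Fin 4) → EuclideanSpace ℝ (Fin 4), ∀ g x,
        m g x = !₂[g 0 * x 0 - g 1 * x 1 - g 2 * x 2 - g 3 * x 3,
                   g 0 * x 1 + g 1 * x 0 + g 2 * x 3 - g 3 * x 2,
                   g 0 * x 2 - g 1 * x 3 + g 2 * x 0 + g 3 * x 1,
                   g 0 * x 3 + g 1 * x 2 - g 2 * x 1 + g 3 * x 0] :=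
    ⟨_, fun _ _ ↦ rfl⟩
  have hnorm : ∀ g x, ‖m g x‖ = ‖g‖ * ‖x‖ := fun g x ↦ by
    have hsq : ‖m g x‖ ^ 2 = (‖g‖ * ‖x‖) ^ 2 := by
      rw [mul_pow, EuclideanSpace.real_norm_sq_eq, EuclideanSpace.real_norm_sq_eq,
        EuclideanSpace.real_norm_sq_eq]
      simp [hm, Fin.sum_univ_four]
      ring
    exact (sq_eq_sq₀ (norm_nonneg _) (by positivity)).1 hsq
  have hunit : ∀ g, m g (EuclideanSpace.single 0 1) = g := fun g ↦ by
    ext i; fin_cases i <;> simp [hm]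
  have hadd₁ : ∀ g₁ g₂ x, m (g₁ + g₂) x = m g₁ x + m g₂ x := fun g₁ g₂ x ↦ by
    ext i; fin_cases i <;> simp [hm] <;> ring
  have hsmul₁ : ∀ (c : ℝ) g x, m (c • g) x = c • m g x := fun c g x ↦ by
    ext i; fin_cases i <;> simp [hm] <;> ring
  have hadd₂ : ∀ g x₁ x₂, m g (x₁ + x₂) = m g x₁ + m g x₂ := fun g x₁ x₂ ↦ by
    ext i; fin_cases i <;> simp [hm] <;> ring
  have hsmul₂ : ∀ (c : ℝ) g x, m g (c • x) = c • m g x := fun c g x ↦ by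
    ext i; fin_cases i <;> simp [hm] <;> ring
  clear hm
  refine ⟨(LinearMap.mk₂ ℝ m hadd₁ hsmul₁ hadd₂ hsmul₂).mkContinuous₂ 1 fun g x ↦ ?_,
    fun g ↦ ?_, fun g x ↦ ?_⟩
  · rw [LinearMap.mk₂_apply, hnorm, one_mul]
  · rw [LinearMap.mkContinuous₂_apply, LinearMap.mk₂_apply, hunit]
  · rw [LinearMap.mkContinuous₂_apply, LinearMap.mk₂_apply, hnorm]

/-- **Octonion (Cayley) multiplication on `ℝ⁸`** (Cayley–Dickson doubling of the quaternions,
`(a, b)(c, d) = (ac - d̄b, da + bc̄)`) as a continuous bilinear map with multiplicative norm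
(Degen's eight-square identity) and unit `e₀`; associativity is not needed (and fails).
[folklore] -/
theorem exists_norm_mul_eight :
    ∃ B : EuclideanSpace ℝ (Fin 8) →L[ℝ] EuclideanSpace ℝ (Fin 8) →L[ℝ] EuclideanSpace ℝ (Fin 8),
      (∀ g, B g (EuclideanSpace.single 0 1) = g) ∧ ∀ g x, ‖B g x‖ = ‖g‖ * ‖x‖ := by
  -- the multiplication, kept opaque (`m`, `hm`) so that the case splits below stay small
  obtain ⟨m, hm⟩ :
      ∃ m : EuclideanSpace ℝ (Fin 8) → EuclideanSpace ℝ (Fin 8) → EuclideanSpace ℝ (Fin 8), ∀ g x,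
        m g x = !₂[
      g 0 * x 0 - g 1 * x 1 - g 2 * x 2 - g 3 * x 3 - g 4 * x 4 - g 5 * x 5 - g 6 * x 6 - g 7 * x 7,
      g 0 * x 1 + g 1 * x 0 + g 2 * x 3 - g 3 * x 2 + g 4 * x 5 - g 5 * x 4 - g 6 * x 7 + g 7 * x 6,
      g 0 * x 2 - g 1 * x 3 + g 2 * x 0 + g 3 * x 1 + g 4 * x 6 + g 5 * x 7 - g 6 * x 4 - g 7 * x 5,
      g 0 * x 3 + g 1 * x 2 - g 2 * x 1 + g 3 * x 0 + g 4 * x 7 - g 5 * x 6 + g 6 * x 5 - g 7 * x 4,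
      g 0 * x 4 - g 1 * x 5 - g 2 * x 6 - g 3 * x 7 + g 4 * x 0 + g 5 * x 1 + g 6 * x 2 + g 7 * x 3,
      g 0 * x 5 + g 1 * x 4 - g 2 * x 7 + g 3 * x 6 - g 4 * x 1 + g 5 * x 0 - g 6 * x 3 + g 7 * x 2,
      g 0 * x 6 + g 1 * x 7 + g 2 * x 4 - g 3 * x 5 - g 4 * x 2 + g 5 * x 3 + g 6 * x 0 - g 7 * x 1,
      g 0 * x 7 - g 1 * x 6 + g 2 * x 5 + g 3 * x 4 - g 4 * x 3 - g 5 * x 2 + g 6 * x 1 + g 7 * x 0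
    ] :=
    ⟨_, fun _ _ ↦ rfl⟩
  have hnorm : ∀ g x, ‖m g x‖ = ‖g‖ * ‖x‖ := fun g x ↦ by
    have hsq : ‖m g x‖ ^ 2 = (‖g‖ * ‖x‖) ^ 2 := by
      rw [mul_pow, EuclideanSpace.real_norm_sq_eq, EuclideanSpace.real_norm_sq_eq,
        EuclideanSpace.real_norm_sq_eq]
      simp [hm, Fin.sum_univ_eight]
      ring
    exact (sq_eq_sq₀ (norm_nonneg _) (by positivity)).1 hsq
  have hunit : ∀ g, m g (EuclideanSpace.single 0 1) = g := fun g ↦ by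
    ext i; fin_cases i <;> simp [hm]
  have hadd₁ : ∀ g₁ g₂ x, m (g₁ + g₂) x = m g₁ x + m g₂ x := fun g₁ g₂ x ↦ by
    ext i; fin_cases i <;> simp [hm] <;> ring
  have hsmul₁ : ∀ (c : ℝ) g x, m (c • g) x = c • m g x := fun c g x ↦ by
    ext i; fin_cases i <;> simp [hm] <;> ring
  have hadd₂ : ∀ g x₁ x₂, m g (x₁ + x₂) = m g x₁ + m g x₂ := fun g x₁ x₂ ↦ by
    ext i; fin_cases i <;> simp [hm] <;> ring
  have hsmul₂ : ∀ (c : ℝ) g x, m g (c • x) = c • m g x := fun c g x ↦ by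
    ext i; fin_cases i <;> simp [hm] <;> ring
  clear hm
  refine ⟨(LinearMap.mk₂ ℝ m hadd₁ hsmul₁ hadd₂ hsmul₂).mkContinuous₂ 1 fun g x ↦ ?_,
    fun g ↦ ?_, fun g x ↦ ?_⟩
  · rw [LinearMap.mk₂_apply, hnorm, one_mul]
  · rw [LinearMap.mkContinuous₂_apply, LinearMap.mk₂_apply, hunit]
  · rw [LinearMap.mkContinuous₂_apply, LinearMap.mk₂_apply, hnorm]

end Algebras

/-! ### The spheres `𝕊⁰, 𝕊¹, 𝕊³, 𝕊⁷` are parallelizable -/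

section Spheres

open Metric

/-- `𝕊⁰` is parallelizable: its tangent bundle has rank `0`, a framing is the empty family.
[folklore] -/
theorem isParallelizable_sphere_zero :
    IsParallelizable (𝓡 0) (sphere (0 : EuclideanSpace ℝ (Fin (0 + 1))) 1) := by
  haveI : IsEmpty (Fin (finrank ℝ (EuclideanSpace ℝ (Fin 0)))) := by
    rw [finrank_euclideanSpace_fin]
    infer_instance
  exact ⟨fun _ _ ↦ 0, fun i ↦ isEmptyElim i, fun _ ↦ linearIndependent_empty_type⟩

/-- `𝕊¹` is parallelizable (framed by complex multiplication: the unit tangent field `ig`)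
(Dieudonné, *Treatise on Analysis* III, (16.15) Problem 1; Lee, Example 8.10).
[cite: DieudonneAnalysisIII1972, (16.15) Problem 1] -/
theorem isParallelizable_sphere_one :
    IsParallelizable (𝓡 1) (sphere (0 : EuclideanSpace ℝ (Fin (1 + 1))) 1) := by
  haveI : Fact (finrank ℝ (EuclideanSpace ℝ (Fin 2)) = 1 + 1) := ⟨finrank_euclideanSpace_fin⟩
  obtain ⟨B, hBe, hB⟩ := exists_norm_mul_two
  exact isParallelizable_sphere_of_norm_mul B _ hBe hB

/-- `𝕊³` is parallelizable (framed by quaternionic multiplication: `ig, jg, kg`)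
(Dieudonné, *Treatise on Analysis* III, (16.15) Problem 1; Lee, Problem 8-6).
[cite: DieudonneAnalysisIII1972, (16.15) Problem 1] [cite: LeeSmoothManifolds2013, Problem 8-6] -/
theorem isParallelizable_sphere_three :
    IsParallelizable (𝓡 3) (sphere (0 : EuclideanSpace ℝ (Fin (3 + 1))) 1) := by
  haveI : Fact (finrank ℝ (EuclideanSpace ℝ (Fin 4)) = 3 + 1) := ⟨finrank_euclideanSpace_fin⟩
  obtain ⟨B, hBe, hB⟩ := exists_norm_mul_four
  exact isParallelizable_sphere_of_norm_mul B _ hBe hB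

/-- `𝕊⁷` is parallelizable (framed by octonionic multiplication: `e₁g, …, e₇g`)
(Dieudonné, *Treatise on Analysis* III, (16.15) Problem 2: "in particular `S₇` is a
parallelizable manifold"; Lee, Problem 8-7).
[cite: DieudonneAnalysisIII1972, (16.15) Problem 2] [cite: LeeSmoothManifolds2013, Problem 8-7] -/
theorem isParallelizable_sphere_seven :
    IsParallelizable (𝓡 7) (sphere (0 : EuclideanSpace ℝ (Fin (7 + 1))) 1) := by
  haveI : Fact (finrank ℝ (EuclideanSpace ℝ (Fin 8)) = 7 + 1) := ⟨finrank_euclideanSpace_fin⟩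
  obtain ⟨B, hBe, hB⟩ := exists_norm_mul_eight
  exact isParallelizable_sphere_of_norm_mul B _ hBe hB

/-- **The "if" half of `Literature.Topology.FourManifolds.isParallelizable_sphere_iff`** (the classical half of
Bott–Milnor–Kervaire): `𝕊ⁿ` is parallelizable for `n ∈ {0, 1, 3, 7}` — `𝕊⁰` trivially (rank `0`),
`𝕊¹, 𝕊³, 𝕊⁷` by complex, quaternionic and octonionic multiplication (Ebbinghaus et al., *Numbers*,
Ch. 11 §1.5 Theorem; Dieudonné, *Treatise on Analysis* III, (16.15) Problems 1–2; Lee,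
*Introduction to Smooth Manifolds*, p. 179).
[cite: EbbinghausEtAl1991, Ch. 11 §1.5 Theorem]
[cite: DieudonneAnalysisIII1972, (16.15) Problems 1–2] -/
theorem isParallelizable_sphere_of_mem {n : ℕ} (hn : n ∈ ({0, 1, 3, 7} : Set ℕ)) :
    IsParallelizable (𝓡 n) (sphere (0 : EuclideanSpace ℝ (Fin (n + 1))) 1) := by
  simp only [Set.mem_insert_iff, Set.mem_singleton_iff] at hn
  rcases hn with rfl | rfl | rfl | rfl
  exacts [isParallelizable_sphere_zero, isParallelizable_sphere_one,
    isParallelizable_sphere_three, isParallelizable_sphere_seven]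

/-- The "if" half of `Literature.Topology.FourManifolds.isParallelizable_sphere_iff`, with the binder shape of that named fact
(`∀ n, … ↔ n ∈ {0, 1, 3, 7}`, right-to-left). [cite: EbbinghausEtAl1991, Ch. 11 §1.5 Theorem] -/
theorem isParallelizable_sphere_iff_mpr (n : ℕ) (hn : n ∈ ({0, 1, 3, 7} : Set ℕ)) :
    IsParallelizable (𝓡 n) (sphere (0 : EuclideanSpace ℝ (Fin (n + 1))) 1) :=
  isParallelizable_sphere_of_mem hn

end Spheres

end Literature.Topology.FourManifolds
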